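import Literature.Topology.FourManifolds.FlowoutOfIncomingBoundary
import Literature.Topology.FourManifolds.UnstableSetRadial
import Literature.Topology.FourManifolds.GradientLikeTrajectories
import Literature.Topology.FourManifolds.OneHandlebodyArcsExposed
import Literature.AlgebraicTopology.FundamentalGroup.PosDetMatrixFundamentalGroup
import HarnessLib

/-!
# The basin of the `0`-handle of a `1`-handlebody: complement of the co-cores, simply connected

Topic `Literature/Topology/FourManifolds`; Morse-theoretic infrastructure for the cut-system
arguments on `3`-dimensional handlebodies (the "Torelli" half of Griffiths' handlebody theorem,
`HandlebodyKernelExtensionTorelli.lean`: words of curves read through their crossings with the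
co-core discs).  Everything here is **proved**; no definitions and no named facts.

Let `W` be a compact smooth `(n+1)`-manifold with boundary carrying a Morse function `g`
adapted to `∂W` (a Morse function of the triad `(W; ∅, ∂W)`) with a gradient-like field `ξ`.
The **co-core** (ascending disc, Milnor's right-hand disc) of a critical point `q` is its
unstable set `unstableSet ξ q`; the **basin** of the minimum `p₀` is `unstableSet ξ p₀`.

* `Cobordism.IsMorseFunction.exists_mem_unstableSet_ofBoundary` — **every point of `W` lies on
  the ascending set of some critical point** (Milnor 1965, Thm. 4.1: trajectories start on
  `V₀ = ∅` or at a critical point; the tree's `Milnor1965_mem_flowout_or_mem_unstableSet`);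
  hence (`…mem_unstableSet_or_exists_of_index_le_one`) **a `1`-handlebody is the disjoint union
  of the basin of its `0`-handle and the co-cores of its `1`-handles**.
* `Cobordism.IsMorseFunction.isOpen_unstableSet_ofBoundary` — the basin is open (Milnor 1965,
  Def. 3.1 (2) at an index-`0` point; the tree's `isOpen_unstableSet_of_mem_criticalSetOfIndex_zero`).
* `Cobordism.IsNiceMorseFunction.path_homotopic_of_forall_mem_unstableSet` — **the basin is simply
  connected inside `W`**: two paths with the same end points running in the basin below the top
  level are homotopic rel end points in `W`.  Proof: flow both backwards for a time `T` into the
  ball `{g ≤ t₁}` of the `0`-handle (uniform in the compact path by a directed open cover;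
  `g` decreases along backward trajectories, which converge to `p₀`), where they are homotopic
  (the ball is the injective continuous image of the closed unit ball, a convex set), and flow
  the homotopy forward again (`θ_T ∘ θ_{-T} = id`).  With the first bullet: *the complement of
  the co-cores in a `1`-handlebody is simply connected* — the fact behind "the word of a
  null-homotopic curve in the co-cores reduces to the empty word" (a handlebody cut along a cut
  system is a ball; Hensel (2020), §5; Johnson, *Notes on Heegaard splittings*, Lemma 2.7).

## References

* J. Milnor, *Lectures on the h-cobordism theorem* (1965), Def. 3.1, Def. 3.9, proof of
  Thm. 4.1 (PDF p. 22), Thm. 3.14. [MilnorHCobordism1965]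
* S. Hensel, *A primer on handlebody groups* (2020), §5 (cut systems). [Hensel2020HandlebodyPrimer]
* A. Hatcher, *Algebraic Topology* (2002), Prop. 1.17, Example 1.22. [HatcherAT2002]
-/

open scoped Manifold ContDiff Topology unitInterval
open Set Function Metric Filter

noncomputable section

namespace Literature.Topology.FourManifolds

open BoundaryManifold Literature.AlgebraicTopology.FundamentalGroup

universe u

variable {n : ℕ} {W : Type u} [TopologicalSpace W] [T2Space W] [SecondCountableTopology W]
  [CompactSpace W] [ChartedSpace (EuclideanHalfSpace (n + 1)) W] [IsManifold (𝓡∂ (n + 1)) ∞ W]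

/-! ### §1 Every point lies on an ascending set; the basin and the co-cores exhaust `W` -/

/-- **Every point of a compact manifold with boundary lies on the ascending (unstable) set of a
critical point** of a Morse function adapted to the boundary with a gradient-like field: the
incoming boundary of the triad `(W; ∅, ∂W)` is empty, so Milnor's dichotomy (trajectories start
on `V₀` or at a critical point, `Milnor1965_mem_flowout_or_mem_unstableSet`) leaves only the
second alternative. [cite: MilnorHCobordism1965, proof of Thm. 4.1 (PDF p. 22)] -/
theorem Cobordism.IsMorseFunction.exists_mem_unstableSet_ofBoundary
    {g : (Cobordism.ofBoundary n W).W → ℝ} (hg : (Cobordism.ofBoundary n W).IsMorseFunction g)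
    (ξ : Cₛ^∞⟮𝓡∂ (n + 1); EuclideanSpace ℝ (Fin (n + 1)),
      (TangentSpace (𝓡∂ (n + 1)) : (Cobordism.ofBoundary n W).W → Type)⟯)
    (hξ : IsGradientLike (𝓡∂ (n + 1)) g ξ) (x : W) :
    ∃ q, IsMCriticalPt (𝓡∂ (n + 1)) g q ∧ x ∈ unstableSet (𝓡∂ (n + 1)) ξ q := by
  haveI : CompactSpace ((𝓡∂ (n + 1)).boundary W) := compactSpace_boundary n W
  rcases Cobordism.Milnor1965_mem_flowout_or_mem_unstableSet_holds hg ξ hξ x with h | h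
  · obtain ⟨γ, t₀, -, -, -, ⟨e, -⟩⟩ := h
    exact e.elim
  · exact h

/-- **A `1`-handlebody is the union of the basin of its `0`-handle and the co-cores of its
`1`-handles**: if the critical points have index `≤ 1` and `p₀` is the unique one of index `0`,
every point lies on the unstable set of `p₀` or on the unstable set of a critical point of
index `1` (and these sets are pairwise disjoint, `disjoint_unstableSet`).
[cite: MilnorHCobordism1965, proof of Thm. 4.1 (PDF p. 22), Def. 3.9] -/
theorem Cobordism.IsMorseFunction.mem_unstableSet_or_exists_of_index_le_one
    {g : (Cobordism.ofBoundary n W).W → ℝ} (hg : (Cobordism.ofBoundary n W).IsMorseFunction g)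
    (ξ : Cₛ^∞⟮𝓡∂ (n + 1); EuclideanSpace ℝ (Fin (n + 1)),
      (TangentSpace (𝓡∂ (n + 1)) : (Cobordism.ofBoundary n W).W → Type)⟯)
    (hξ : IsGradientLike (𝓡∂ (n + 1)) g ξ)
    (hidx : ∀ z ∈ criticalSet (𝓡∂ (n + 1)) g, morseIndex (𝓡∂ (n + 1)) g z ≤ 1)
    {p₀ : W} (hp₀ : criticalSetOfIndex (𝓡∂ (n + 1)) g 0 = {p₀}) (x : W) :
    x ∈ unstableSet (𝓡∂ (n + 1)) ξ p₀ ∨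
      ∃ q ∈ criticalSetOfIndex (𝓡∂ (n + 1)) g 1, x ∈ unstableSet (𝓡∂ (n + 1)) ξ q := by
  obtain ⟨q, hq, hx⟩ := hg.exists_mem_unstableSet_ofBoundary ξ hξ x
  have hle := hidx q (mem_criticalSet.2 hq)
  rcases Nat.le_one_iff_eq_zero_or_eq_one.1 hle with h0 | h1
  · left
    have hmem : q ∈ criticalSetOfIndex (𝓡∂ (n + 1)) g 0 := ⟨hq, h0⟩
    rw [hp₀] at hmem
    have hqp : q = p₀ := hmem
    rwa [hqp] at hx
  · exact Or.inr ⟨q, ⟨hq, h1⟩, hx⟩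

/-- **The basin of an index-`0` critical point is open** (thin restatement of the tree's
`isOpen_unstableSet_of_mem_criticalSetOfIndex_zero` with its two flow facts discharged).
[cite: MilnorHCobordism1965, Def. 3.1 (2), Def. 3.9] -/
theorem Cobordism.IsMorseFunction.isOpen_unstableSet_ofBoundary
    {g : (Cobordism.ofBoundary n W).W → ℝ} (hg : (Cobordism.ofBoundary n W).IsMorseFunction g)
    (ξ : Cₛ^∞⟮𝓡∂ (n + 1); EuclideanSpace ℝ (Fin (n + 1)),
      (TangentSpace (𝓡∂ (n + 1)) : (Cobordism.ofBoundary n W).W → Type)⟯)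
    (hξ : IsGradientLike (𝓡∂ (n + 1)) g ξ) {p₀ : W}
    (hp₀ : p₀ ∈ criticalSetOfIndex (𝓡∂ (n + 1)) g 0) :
    IsOpen (unstableSet (𝓡∂ (n + 1)) ξ p₀) := by
  haveI : CompactSpace ((𝓡∂ (n + 1)).boundary W) := compactSpace_boundary n W
  exact hg.isOpen_unstableSet_of_mem_criticalSetOfIndex_zero
    Cobordism.Milnor1965_eventually_mem_flowout_holds
    Cobordism.Milnor1965_unstableSet_mem_nhds_holds hξ hp₀

/-! ### §2 Paths in the basin are homotopic: flowing back into the ball of the `0`-handle -/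

/-- **Paths in the injective continuous image of a closed ball are homotopic rel end points**
(in the ambient space): pull back along the embedding (a homeomorphism onto its compact image)
to the convex, hence simply connected, closed ball (end points transported with the tree's
`GLPos3.homotopic_of_cast`). [cite: HatcherAT2002, §1.1 (Example 1.4, convexity)] -/
theorem Path.homotopic_of_forall_mem_range_of_injective {Y : Type*} [TopologicalSpace Y] [T2Space Y]
    {m : ℕ} (β : C(closedBall (0 : EuclideanSpace ℝ (Fin m)) 1, Y)) (hβ : Injective β)
    {x y : Y} (γ₁ γ₂ : Path x y) (h₁ : ∀ s, γ₁ s ∈ range β) (h₂ : ∀ s, γ₂ s ∈ range β) :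
    γ₁.Homotopic γ₂ := by
  -- the closed ball is convex, hence simply connected
  haveI : ContractibleSpace (closedBall (0 : EuclideanSpace ℝ (Fin m)) 1) :=
    (convex_closedBall (0 : EuclideanSpace ℝ (Fin m)) 1).contractibleSpace
      ⟨0, mem_closedBall_self zero_le_one⟩
  -- `β` is a homeomorphism onto its range
  set e : closedBall (0 : EuclideanSpace ℝ (Fin m)) 1 ≃ₜ range β :=
    (β.continuous.isClosedEmbedding hβ).isEmbedding.toHomeomorph with he
  have he' : ∀ u, ((e u : range β) : Y) = β u := fun u => rfl
  have hback : ∀ w : range β, β (e.symm w) = (w : Y) := fun w => by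
    rw [← he' (e.symm w), e.apply_symm_apply]
  -- pull the paths back
  have hx : x ∈ range β := γ₁.source ▸ h₁ 0
  have hy : y ∈ range β := γ₁.target ▸ h₁ 1
  let lift : ∀ (γ : Path x y), (∀ s, γ s ∈ range β) →
      Path (e.symm ⟨x, hx⟩) (e.symm ⟨y, hy⟩) := fun γ hγ =>
    { toFun := fun s => e.symm ⟨γ s, hγ s⟩
      continuous_toFun := e.symm.continuous.comp (γ.continuous.subtype_mk _)
      source' := by
        show e.symm ⟨γ 0, _⟩ = e.symm ⟨x, hx⟩
        congr 1
        exact Subtype.ext γ.source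
      target' := by
        show e.symm ⟨γ 1, _⟩ = e.symm ⟨y, hy⟩
        congr 1
        exact Subtype.ext γ.target }
  have hlift : ∀ (γ : Path x y) (hγ : ∀ s, γ s ∈ range β) (s : I), β (lift γ hγ s) = γ s :=
    fun γ hγ s => hback ⟨γ s, hγ s⟩
  have hx' : β (e.symm ⟨x, hx⟩) = x := hback ⟨x, hx⟩
  have hy' : β (e.symm ⟨y, hy⟩) = y := hback ⟨y, hy⟩
  -- they are homotopic in the ball, hence their images are homotopic in `W`
  have hhom : (lift γ₁ h₁).Homotopic (lift γ₂ h₂) := SimplyConnectedSpace.paths_homotopic _ _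
  have himg := hhom.map β
  have e₁ : (lift γ₁ h₁).map β.continuous = γ₁.cast hx' hy' := by
    ext s
    exact hlift γ₁ h₁ s
  have e₂ : (lift γ₂ h₂).map β.continuous = γ₂.cast hx' hy' := by
    ext s
    exact hlift γ₂ h₂ s
  rw [e₁, e₂] at himg
  exact GLPos3.homotopic_of_cast γ₁ γ₂ hx' hy' himg

/-- **The basin of the `0`-handle is simply connected inside `W`.**  Let `g` be a nice Morse
function on `(W; ∅, ∂W)` with one critical point of index `0`, `p₀`, and none of index `≥ 2`,
and `ξ` a gradient-like field.  Then any two paths with the same end points which run in the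
unstable set of `p₀` (the complement of the co-cores of the `1`-handles) and below the top level
`∂W = g⁻¹(1)` are homotopic rel end points in `W`.  Proof: along the flow `θ` of `ξ` (cut off
near `g = 0, 1`) every backward trajectory in the basin converges to `p₀`, and `g` decreases
along it; so for `T` large (uniformly on the compact paths, by a directed open cover) `θ_{-T}`
carries both paths into the ball `{g ≤ t₁}` of the `0`-handle, the injective continuous image
of a closed ball, where they are homotopic; and `θ_T` carries that homotopy back.
[cite: MilnorHCobordism1965, Def. 3.1, proof of Thm. 4.1 (PDF p. 22), Thm. 3.14] [cite: HatcherAT2002, Prop. 1.17] -/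
theorem Cobordism.IsNiceMorseFunction.path_homotopic_of_forall_mem_unstableSet
    {g : (Cobordism.ofBoundary n W).W → ℝ} (hg : (Cobordism.ofBoundary n W).IsNiceMorseFunction g)
    (ξ : Cₛ^∞⟮𝓡∂ (n + 1); EuclideanSpace ℝ (Fin (n + 1)),
      (TangentSpace (𝓡∂ (n + 1)) : (Cobordism.ofBoundary n W).W → Type)⟯)
    (hξ : IsGradientLike (𝓡∂ (n + 1)) g ξ)
    (h0 : (criticalSetOfIndex (𝓡∂ (n + 1)) g 0).ncard = 1)
    (h2 : ∀ k, 2 ≤ k → (criticalSetOfIndex (𝓡∂ (n + 1)) g k).ncard = 0)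
    {p₀ : W} (hp₀ : criticalSetOfIndex (𝓡∂ (n + 1)) g 0 = {p₀})
    {x y : W} (γ₁ γ₂ : Path x y)
    (h₁ : ∀ s, γ₁ s ∈ unstableSet (𝓡∂ (n + 1)) ξ p₀) (h₂ : ∀ s, γ₂ s ∈ unstableSet (𝓡∂ (n + 1)) ξ p₀)
    (hb₁ : ∀ s, g (γ₁ s) < 1) (hb₂ : ∀ s, g (γ₂ s) < 1) :
    γ₁.Homotopic γ₂ := by
  have hgM : (Cobordism.ofBoundary n W).IsMorseFunction g := hg.1
  have hgc : Continuous g := hgM.isMorse.contMDiff.continuous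
  /- the ball of the `0`-handle -/
  obtain ⟨p₀', t₁, β, instP, Φ, hp₀', hgp₀, ht₀, ht₁, -, hβinj, hβrange, -⟩ :=
    hg.exists_ball_union_leftHandDiscs ξ hξ h0 rfl h2
  have hpp : p₀' = p₀ := by
    have h' : p₀' ∈ criticalSetOfIndex (𝓡∂ (n + 1)) g 0 := by rw [hp₀']; exact mem_singleton _
    rw [hp₀] at h'
    exact h'
  subst hpp
  have hp₀mem : p₀' ∈ criticalSetOfIndex (𝓡∂ (n + 1)) g 0 := by rw [hp₀']; exact mem_singleton _
  have hp₀val : g p₀' = Cobordism.niceLevel n 0 := (hg.2 p₀' hp₀mem.1).trans (by rw [hp₀mem.2])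
  /- the slab `[a₀, a₁]` containing the two paths and the level of `p₀` -/
  obtain ⟨s₁, -, hs₁⟩ := isCompact_univ.exists_isMaxOn univ_nonempty (hgc.comp γ₁.continuous).continuousOn
  obtain ⟨s₂, -, hs₂⟩ := isCompact_univ.exists_isMaxOn univ_nonempty (hgc.comp γ₂.continuous).continuousOn
  set a₀ : ℝ := Cobordism.niceLevel n 0 / 2 with ha₀
  set a₁ : ℝ := max (max (g (γ₁ s₁)) (g (γ₂ s₂))) ((1 + Cobordism.niceLevel n 0) / 2) with ha₁
  have hν₀ := Cobordism.niceLevel_pos n 0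
  have hν₁ : Cobordism.niceLevel n 0 < 1 := Cobordism.niceLevel_lt_one (by omega)
  have ha₀pos : 0 < a₀ := by rw [ha₀]; linarith
  have ha₀₁ : a₀ < a₁ := by
    rw [ha₀, ha₁]
    exact lt_of_lt_of_le (by linarith) (le_max_right _ _)
  have ha₁lt : a₁ < 1 := by
    rw [ha₁]
    refine max_lt (max_lt (hb₁ s₁) (hb₂ s₂)) (by linarith)
  have hγ₁le : ∀ s, g (γ₁ s) ≤ a₁ := fun s =>
    le_trans (hs₁ (mem_univ s)) ((le_max_left _ _).trans (le_max_left _ _))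
  have hγ₂le : ∀ s, g (γ₂ s) ≤ a₁ := fun s =>
    le_trans (hs₂ (mem_univ s)) ((le_max_right _ _).trans (le_max_left _ _))
  have hp₀a₀ : a₀ ≤ g p₀' := by rw [hp₀val, ha₀]; linarith
  /- the slab flow -/
  obtain ⟨θ, hθ⟩ := hgM.exists_slabFlow ξ.contMDiff hξ ha₀pos ha₀₁ ha₁lt
  have hflow := hθ.isSmoothFlow
  have hθc : Continuous θ := hflow.continuous
  have hθT : ∀ T : ℝ, Continuous fun z : W => θ (T, z) := fun T =>
    hθc.comp (continuous_const.prodMk continuous_id)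
  -- backward trajectories in the basin converge to `p₀`
  have hconv : ∀ z, z ∈ unstableSet (𝓡∂ (n + 1)) ξ p₀' → g z ≤ a₁ →
      Tendsto (fun t => θ (t, z)) atBot (𝓝 p₀') := fun z hz hzle =>
    (hθ.toPreSlabFlow.mem_unstableSet_iff_tendsto hzle hp₀a₀).1 hz
  /- a uniform time `T` bringing both paths into `{g < t₁}` -/
  set O : ℝ → Set W := fun T => {z | g (θ (-T, z)) < t₁} with hO
  have hOopen : ∀ T, IsOpen (O T) := fun T =>
    isOpen_lt (hgc.comp (hθT (-T))) continuous_const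
  have hOdir : Directed (· ⊆ ·) O := by
    refine Monotone.directed_le fun T T' hTT' z hz => ?_
    have hmono := hθ.toPreSlabFlow.monotone z (neg_le_neg hTT')
    exact lt_of_le_of_lt hmono hz
  set K : Set W := range γ₁ ∪ range γ₂ with hK
  have hKc : IsCompact K := (isCompact_range γ₁.continuous).union (isCompact_range γ₂.continuous)
  have hKO : K ⊆ ⋃ T, O T := by
    intro z hz
    have hzU : z ∈ unstableSet (𝓡∂ (n + 1)) ξ p₀' ∧ g z ≤ a₁ := by
      rcases hz with ⟨s, rfl⟩ | ⟨s, rfl⟩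
      · exact ⟨h₁ s, hγ₁le s⟩
      · exact ⟨h₂ s, hγ₂le s⟩
    have hev : ∀ᶠ t in atBot, g (θ (t, z)) < t₁ :=
      (hconv z hzU.1 hzU.2).eventually ((isOpen_lt hgc continuous_const).mem_nhds hgp₀)
    obtain ⟨t, ht⟩ := hev.exists
    exact mem_iUnion.2 ⟨-t, by show g (θ (-(-t), z)) < t₁; rw [neg_neg]; exact ht⟩
  obtain ⟨T, hT⟩ := hKc.elim_directed_cover O hOopen hKO hOdir
  have hT₁ : ∀ s, g (θ (-T, γ₁ s)) < t₁ := fun s => hT (Or.inl (mem_range_self s))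
  have hT₂ : ∀ s, g (θ (-T, γ₂ s)) < t₁ := fun s => hT (Or.inr (mem_range_self s))
  /- the flowed-back paths lie in the ball and are homotopic there -/
  set δ₁ : Path (θ (-T, x)) (θ (-T, y)) := γ₁.map (hθT (-T)) with hδ₁
  set δ₂ : Path (θ (-T, x)) (θ (-T, y)) := γ₂.map (hθT (-T)) with hδ₂
  have hδ₁B : ∀ s, δ₁ s ∈ range β := fun s => by
    rw [hβrange]; exact (hT₁ s).le
  have hδ₂B : ∀ s, δ₂ s ∈ range β := fun s => by
    rw [hβrange]; exact (hT₂ s).le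
  have hδ : δ₁.Homotopic δ₂ := Path.homotopic_of_forall_mem_range_of_injective β hβinj δ₁ δ₂ hδ₁B hδ₂B
  /- flow the homotopy forward -/
  have hback : ∀ z : W, θ (T, θ (-T, z)) = z := fun z => by
    rw [hflow.map_add, add_neg_cancel, hflow.map_zero]
  have himg := hδ.map ⟨fun z => θ (T, z), hθT T⟩
  have e₁ : δ₁.map (hθT T) = γ₁.cast (hback x) (hback y) := by
    ext s
    exact hback (γ₁ s)
  have e₂ : δ₂.map (hθT T) = γ₂.cast (hback x) (hback y) := by
    ext s
    exact hback (γ₂ s)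
  have himg' : (δ₁.map (hθT T)).Homotopic (δ₂.map (hθT T)) := himg
  rw [e₁, e₂] at himg'
  exact GLPos3.homotopic_of_cast γ₁ γ₂ (hback x) (hback y) himg'

end Literature.Topology.FourManifolds

end
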